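import Summits.Ventures.HodgeRepro2.T5SU11LegendreRatioLimit

/-!
# The root limit `P_n(x)^{1/n} → ρ(x)` and `φ_{2n+2}(g)^{1/n} → (|a| + |b|)²`

From the ratio limit `P_{n+1}(x)/P_n(x) → ρ(x)` (`T5SU11LegendreRatioLimit.tendsto_legP_ratio`) by Cesàro means:
`log P_n(x) = Σ_{m<n} log(P_{m+1}/P_m)` (`log_legP_eq_sum`), so `(1/n) log P_n(x) → log ρ(x)` (Mathlib's
`Filter.Tendsto.cesaro`) and **`P_n(x)^{1/n} → ρ(x)`** (`tendsto_legP_rpow_inv`); on the group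
**`φ_{2n+2}(g)^{1/n} → (|a(g)| + |b(g)|)²`** (`tendsto_sph_even_rpow_inv`) — the exponential growth rate of the
spherical functions of even parameter in the parameter. Nothing is claimed about (N).

Blind lane: Mathlib + the HodgeRepro2 prefix only; no sorry; axioms ⊆ {propext, Classical.choice,
Quot.sound}.
-/

namespace Summit.Ventures.HodgeRepro2.T5SU11LegendreRootLimit

open MeasureTheory Metric Set Filter Topology Finset
open T5SU11Unimodular T5SU11Cartan T5BergmanCoefficient T5SU11SphericalFunction T5SU11SphericalLegendre
  T5SU11SphericalLegendreAll T5SU11LegendreGenerating T5SU11LegendreSummary T5SU11LegendreRatioLimit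

/-- **`log P_n(x) = Σ_{m<n} log(P_{m+1}(x)/P_m(x))`** for `x ≥ 1`. -/
theorem log_legP_eq_sum (n : ℕ) {x : ℝ} (hx : 1 ≤ x) :
    Real.log (legP n x) = ∑ m ∈ range n, Real.log (legP (m + 1) x / legP m x) := by
  induction n with
  | zero => simp
  | succ n ih =>
    rw [Finset.sum_range_succ, ← ih]
    have h0 : 0 < legP n x := by linarith [one_le_legP' n hx]
    have h1 : 0 < legP (n + 1) x := by linarith [one_le_legP' (n + 1) hx]
    rw [Real.log_div h1.ne' h0.ne']
    ring

/-- **`(1/n) log P_n(x) → log ρ(x)`** (Cesàro). -/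
theorem tendsto_log_legP_div {x : ℝ} (hx : 1 ≤ x) :
    Tendsto (fun n : ℕ => (n : ℝ)⁻¹ * Real.log (legP n x)) atTop (𝓝 (Real.log (rho x))) := by
  have h := ((tendsto_legP_ratio hx).log (rho_pos hx).ne').cesaro
  refine h.congr fun n => ?_
  rw [log_legP_eq_sum n hx]

/-- **`P_n(x)^{1/n} → ρ(x)`** for `x ≥ 1`. -/
theorem tendsto_legP_rpow_inv {x : ℝ} (hx : 1 ≤ x) :
    Tendsto (fun n : ℕ => legP n x ^ ((n : ℝ)⁻¹)) atTop (𝓝 (rho x)) := by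
  have h := (Real.continuous_exp.tendsto (Real.log (rho x))).comp (tendsto_log_legP_div hx)
  rw [Real.exp_log (rho_pos hx)] at h
  refine h.congr fun n => ?_
  have h0 : 0 < legP n x := by linarith [one_le_legP' n hx]
  simp only [Function.comp_apply]
  rw [Real.rpow_def_of_pos h0, mul_comm]

section measure

variable [MeasurableSpace Circle] [BorelSpace Circle]

/-- **`φ_{2n+2}(g)^{1/n} → (|a(g)| + |b(g)|)²`** as `n → ∞`. -/
theorem tendsto_sph_even_rpow_inv (g : SU11) :
    Tendsto (fun n : ℕ => sph (2 * (n : ℝ) + 2) g ^ ((n : ℝ)⁻¹)) atTop (𝓝 ((‖mat g 0 0‖ + ‖mat g 0 1‖) ^ 2)) := by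
  simp only [sph_even_eq_sph_four]
  rw [← rho_sph_four]
  exact tendsto_legP_rpow_inv (one_le_sph_four g)

end measure

end Summit.Ventures.HodgeRepro2.T5SU11LegendreRootLimit
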